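import Literature.NumberTheory.LFunctions.MoebiusWalshCircuitsProofs
import Literature.NumberTheory.Sieve.MoebiusWalshCircuitsProofs
import Mathlib.Analysis.SpecialFunctions.Trigonometric.Bounds
import HarnessLib

/-!
# Bourgain 2013, Lemma 5: the Fourier-localised substitute `W_A` of a Walsh function — proved

Topic `Literature/NumberTheory/LFunctions`, a sibling of `MoebiusWalshCircuitsProofs.lean` (Bourgain
2013, §1: Lemmas 1–4, 6 and the `ℓ¹` part (1.11) of Lemma 5, all proved there). Everything in this
file is PROVED (theorems, plus `def`s with bodies); no named fact is introduced or discharged.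

J. Bourgain, *Möbius–Walsh correlation bounds and an estimate of Mauduit and Rivat*, J. Anal.
Math. 119 (2013) 147–163 = arXiv:1109.2784 [Bourgain2013MoebiusWalsh], **Lemma 5, second part**
((1.12)–(1.13), construction (1.22)): for a digit set `A ⊂ [λ-σ, λ[` there is a bounded function
`W_A` with `|Ŵ_A| ≤ |ŵ_A|`, `Ŵ_A(k) = 0` for `|k| > 2^{σ+t}`, and
`(2^{-λ}∑_{x<2^λ}|W_A(x) - w_A(x)|²)^{1/2} < 2^{-ct}`; "the role of `W_A` is to provide a substitute
for `w_A` with localized Fourier transform" — it is the device by which the type-II analysis of §2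
((2.3)–(2.4), (2.8)–(2.10)) keeps all frequencies `|k| < 2^{μ+ρ'+t}`. This is the one statement of
§1 not covered by `MoebiusWalshCircuitsProofs.lean`.

## What is proved (namespace `Literature.NumberTheory.LFunctions.MoebiusWalsh`, `λ = q + σ`)

* `walshNat A x` — the Walsh function `w_A` read on a natural number through `Nat.testBit`
  (`= walshSign A (digits x)`, `2^λ`-periodic), with **Fourier inversion over any window of `2^λ`
  consecutive integer frequencies** `walshNat_eq_sum_Ico` (from the tree's
  `walshSign_eq_sum_walshCoeff`) and **Parseval** `sum_Ico_norm_sq_walshCoeff`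
  (`∑_{k ∈ [b, b+2ⁿ)} |ŵ_B(k/2ⁿ)|² = 1`), `sum_norm_sq_trigPoly` (trigonometric polynomials).
* `walshCoeff_eq_dirichletCoeff_mul` — **(1.14)–(1.15)**: if all digits of `A` are `≥ q` then
  `ŵ_A(θ) = D_q(θ) ŵ_{A'}(2^qθ)`, `D_q(θ) = 2^{-q}∑_{x<2^q} e(θx)` (`dirichletCoeff`), `A' = topShift A`;
  and `norm_dirichletCoeff_le`: `|D_q(θ)| ≤ 2^{-q}/(2|θ|)` for `0 < |θ| ≤ 1/2` (geometric sum and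
  Jordan's inequality, `norm_sum_range_eChar_le`).
* `fejerSum`, `fejerSum_eq_sum_Ioo` (Fejér: `|∑_{j<M} e(jθ)|² = ∑_{|k|<M} (M-|k|) e(kθ)`, via the pair
  count `card_filter_sub_eq`), `trapezoid` (the de la Vallée-Poussin multiplier `η`, `= 1` on
  `|k| ≤ N`, `0` beyond `2N`, values in `[0,1]`), `sum_trapezoid_mul_eChar`
  (`∑ η(k)e(kθ) = (Φ_{2N} - Φ_N)/N`) and `sum_fejerSum_sub_div` (a Fejér sum has mean `M` over a period).
* `localisedCoeff`, `localisedWalsh` — **(1.22)**: `Ŵ_A(k) = η(k)ŵ_A(k/2^λ)`,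
  `W_A(x) = ∑_{|k|<2N} Ŵ_A(k) e(-kx/2^λ)`, `N = K₁2^σ`; `norm_localisedCoeff_le` (**(1.13)**,
  `|Ŵ_A| ≤ |ŵ_A|`), `localisedCoeff_eq_zero` (**(1.13)**, `Ŵ_A(k) = 0` for `|k| ≥ 2N`),
  `localisedWalsh_eq_sum_fejer` (`W_A = w_A ∗ V_N`, `V_N = (Φ_{2N}-Φ_N)/N`), `norm_localisedWalsh_le`
  (**`‖W_A‖_∞ ≤ 3`**), `conj_localisedWalsh` (`W_A` is real; `localisedWalshRe`).
* `sum_norm_sq_localisedWalsh_sub_walshNat_le` — **(1.12)**: for `K₁ ≥ 2`, `4K₁ ≤ 2^q`,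
  `∑_{x<2^λ} |W_A(x) - w_A(x)|² ≤ 2^λ/(2(K₁-1))`; packaged with the rest as
  `bourgain2013_lemma5_localised`.

## Deviation from the printed proof (shorter road, better constant)

Bourgain bounds the `ℓ²` tail `∑_{|k₁| ≥ K₁} |ŵ_A(k)|²` through the expansion (1.16) borrowed from
the proof of Lemma 4 and the estimates (1.17)–(1.21), getting `2^{-ρ/2} + K₁^{-c}C^{(log λ)²}` and
hence the side condition `t > C(log λ)²`. Here instead: by (1.15) and PARSEVAL for `ŵ_{A'}` on each
block of `2^σ` consecutive frequencies (`sum_block_norm_sq_walshCoeff_le`), together with the decay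
`|D_q(k/2^λ)| ≤ 2^σ/(2|k|)` of the Dirichlet factor of the `q` free low digits, the tail is at most
`2∑_{i ≥ K₁}(2i)^{-2} ≤ 1/(2(K₁-1))` (`sum_tail_pos_le`, `sum_tail_neg_le`); no lower bound on `t`
is needed and the saving is `K₁^{-1/2} ≍ 2^{-t/2}` in (1.12). The sup bound `‖W_A‖_∞ ≤ 3` is the
classical de la Vallée-Poussin argument (`η̌ = 2F_{2N} - F_N`, Fejér kernels are `≥ 0` of mean `1`).

Conventions as in `MoebiusWalshCircuitsProofs.lean`: `e(t) = eChar t`, `ŵ_A(θ) = walshCoeff A θ`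
carries `e(+θ·val x)`, so inversion and `W_A` carry `e(-kx/2^λ)`; frequencies are integers `k : ℤ`
in centred windows `Finset.Ico (-H) (-H + 2^λ)` / `Finset.Ioo (-2N) (2N)`.

## References

* J. Bourgain, *Möbius–Walsh correlation bounds and an estimate of Mauduit and Rivat*, J. Anal.
  Math. 119 (2013) 147–163; arXiv:1109.2784: §1, Lemma 5, (1.12)–(1.15), (1.22)–(1.23); §2,
  (2.3)–(2.4), (2.8)–(2.10) (where `W_{S'}` is used). [Bourgain2013MoebiusWalsh]
-/

noncomputable section

open Finset Real
open Literature.Computability.Complexity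

namespace Literature.NumberTheory.LFunctions.MoebiusWalsh

/-! ### Sums over windows of consecutive integers -/

/-- Splitting a sum over `[a, c)` at `b`. [folklore] -/
theorem sum_Ico_int_split {M : Type*} [AddCommMonoid M] (f : ℤ → M) {a b c : ℤ} (hab : a ≤ b)
    (hbc : b ≤ c) : ∑ k ∈ Ico a c, f k = ∑ k ∈ Ico a b, f k + ∑ k ∈ Ico b c, f k := by
  rw [← Finset.Ico_union_Ico_eq_Ico hab hbc, Finset.sum_union (Finset.Ico_disjoint_Ico_consecutive a b c)]

/-- A window of `R` consecutive integers starting at `b`, as a shifted `range`. [folklore] -/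
theorem sum_Ico_int_eq_sum_range {M : Type*} [AddCommMonoid M] (f : ℤ → M) (b : ℤ) (R : ℕ) :
    ∑ k ∈ Ico b (b + R), f k = ∑ j ∈ range R, f (b + j) := by
  induction R with
  | zero => simp
  | succ R ih =>
    rw [Finset.sum_range_succ, ← ih, Nat.cast_succ, ← add_assoc]
    rw [sum_Ico_int_split f (b := b + R) (by omega) (by omega)]
    congr 1
    rw [show b + (R : ℤ) + 1 = (b + R) + 1 by ring, Finset.Ico_add_one_right_eq_Icc, Finset.Icc_self,
      Finset.sum_singleton]

/-- Block decomposition of a window of length `n R`. [folklore] -/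
theorem sum_Ico_int_blocks {M : Type*} [AddCommMonoid M] (f : ℤ → M) (a : ℤ) (R n : ℕ) :
    ∑ k ∈ Ico a (a + n * R), f k = ∑ i ∈ range n, ∑ k ∈ Ico (a + i * R) (a + (i + 1) * R), f k := by
  induction n with
  | zero => simp
  | succ n ih =>
    rw [Finset.sum_range_succ, ← ih, Nat.cast_succ]
    exact sum_Ico_int_split f (le_add_of_nonneg_right (by positivity)) (by have := Int.natCast_nonneg R; nlinarith)

/-- A `P`-periodic summand gives the same sum over every window of length `P`. [folklore] -/
theorem sum_Ico_int_eq_of_periodic {M : Type*} [AddCommMonoid M] {f : ℤ → M} {P : ℕ}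
    (hper : ∀ k, f (k + P) = f k) (b : ℤ) (m : ℕ) :
    ∑ k ∈ Ico (b - m) (b - m + P), f k = ∑ k ∈ Ico b (b + P), f k := by
  induction m with
  | zero => simp
  | succ m ih =>
    rw [← ih]
    rcases Nat.eq_zero_or_pos P with hP | hP
    · subst hP; simp
    -- `[b-m-1, b-m-1+P) = {b-m-1} ∪ [b-m, b-m-1+P)` and `[b-m, b-m+P) = [b-m, b-m-1+P) ∪ {b-m-1+P}`
    have h1 := sum_Ico_int_split f (a := b - (m + 1 : ℕ)) (b := b - m) (c := b - (m + 1 : ℕ) + P)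
      (by push_cast; linarith) (by push_cast; omega)
    have h2 := sum_Ico_int_split f (a := b - m) (b := b - (m + 1 : ℕ) + P) (c := b - m + P)
      (by push_cast; omega) (by push_cast; linarith)
    rw [h1, h2]
    have e1 : Ico (b - (m + 1 : ℕ)) (b - m) = {b - (m + 1 : ℕ)} := by
      rw [show (b : ℤ) - m = b - (m + 1 : ℕ) + 1 by push_cast; ring, Finset.Ico_add_one_right_eq_Icc,
        Finset.Icc_self]
    have e2 : Ico (b - (m + 1 : ℕ) + P) (b - m + P) = {b - (m + 1 : ℕ) + P} := by
      rw [show (b : ℤ) - m + P = b - (m + 1 : ℕ) + P + 1 by push_cast; ring,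
        Finset.Ico_add_one_right_eq_Icc, Finset.Icc_self]
    rw [e1, e2, Finset.sum_singleton, Finset.sum_singleton, hper, add_comm]

/-! ### More on the character `e` -/

/-- `conj e(t) = e(-t)`. [folklore] -/
theorem conj_eChar (t : ℝ) : starRingEnd ℂ (eChar t) = eChar (-t) := by
  unfold eChar
  rw [← Complex.exp_conj]
  congr 1
  simp only [map_mul, Complex.conj_ofReal, Complex.conj_I]
  push_cast
  ring

/-- `e(-t) e(t) = 1`. [folklore] -/
theorem eChar_neg_mul (t : ℝ) : eChar (-t) * eChar t = 1 := by
  rw [← eChar_add, neg_add_cancel, eChar_zero]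

/-- **Geometric sums**: `‖∑_{x<Q} e(θx)‖ ≤ 1/(2|θ|)` for `0 < |θ| ≤ 1/2` (from
`|1 - e(θ)| = 2|sin πθ| ≥ 4|θ|`, Jordan's inequality). [folklore] -/
theorem norm_sum_range_eChar_le {θ : ℝ} (h0 : θ ≠ 0) (h1 : |θ| ≤ 1 / 2) (Q : ℕ) :
    ‖∑ x ∈ range Q, eChar (θ * x)‖ ≤ 1 / (2 * |θ|) := by
  have hsin : 2 * |θ| ≤ |Real.sin (π * θ)| := by
    have key : 2 * |θ| ≤ Real.sin (π * |θ|) := by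
      have := Real.mul_le_sin (x := π * |θ|) (by positivity)
        (by nlinarith [abs_nonneg θ, Real.pi_pos])
      calc 2 * |θ| = 2 / π * (π * |θ|) := by field_simp
        _ ≤ _ := this
    rcases abs_choice θ with h | h
    · rw [h] at key ⊢
      exact key.trans (le_abs_self _)
    · rw [h] at key
      rw [show π * θ = -(π * -θ) by ring, Real.sin_neg, abs_neg, h]
      exact key.trans (le_abs_self _)
  have hθpos : 0 < |θ| := abs_pos.2 h0
  have hne : eChar θ ≠ 1 := by
    intro h
    have h2 := norm_one_sub_eChar θ
    rw [h, sub_self, norm_zero] at h2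
    nlinarith
  have hgeom : ∑ x ∈ range Q, eChar (θ * x) = (eChar θ ^ Q - 1) / (eChar θ - 1) := by
    rw [← geom_sum_eq hne]
    refine Finset.sum_congr rfl fun x _ => ?_
    rw [← eChar_nat_mul, mul_comm]
  rw [hgeom, norm_div]
  have hden : ‖eChar θ - 1‖ = 2 * |Real.sin (π * θ)| := by
    rw [← norm_neg, neg_sub, norm_one_sub_eChar]
  have hnum : ‖eChar θ ^ Q - 1‖ ≤ 2 := by
    calc ‖eChar θ ^ Q - 1‖ ≤ ‖eChar θ ^ Q‖ + ‖(1 : ℂ)‖ := norm_sub_le _ _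
      _ = 2 := by rw [norm_pow, norm_eChar, one_pow, norm_one]; norm_num
  rw [hden, div_le_div_iff₀ (by nlinarith) (by positivity)]
  nlinarith [abs_nonneg (Real.sin (π * θ))]

/-! ### The Dirichlet factor of the low digits -/

/-- The normalised Dirichlet kernel of the `q` low digits: `D_q(θ) = 2^{-q} ∑_{x < 2^q} e(θ x)`,
which is `ŵ_∅(θ)` on `q` digits. [folklore] -/
def dirichletCoeff (q : ℕ) (θ : ℝ) : ℂ := ((2 : ℂ) ^ q)⁻¹ * ∑ x ∈ range (2 ^ q), eChar (θ * x)

/-- `D_q = ŵ_∅` (Walsh coefficient of the empty digit set on `q` digits). [folklore] -/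
theorem walshCoeff_empty_eq_dirichletCoeff (q : ℕ) (θ : ℝ) :
    walshCoeff (∅ : Finset (Fin q)) θ = dirichletCoeff q θ := by
  unfold walshCoeff dirichletCoeff
  congr 1
  simp_rw [walshSign_empty, Complex.ofReal_one, one_mul]
  exact sum_digits_eq_sum_range q (fun m => eChar (θ * m))

/-- `|D_q(θ)| ≤ 1`. [folklore] -/
theorem norm_dirichletCoeff_le_one (q : ℕ) (θ : ℝ) : ‖dirichletCoeff q θ‖ ≤ 1 := by
  rw [← walshCoeff_empty_eq_dirichletCoeff]; exact norm_walshCoeff_le_one _ _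

/-- **Decay of the Dirichlet factor**: `|D_q(θ)| ≤ 2^{-q}/(2|θ|)` for `0 < |θ| ≤ 1/2`. [folklore] -/
theorem norm_dirichletCoeff_le {θ : ℝ} (h0 : θ ≠ 0) (h1 : |θ| ≤ 1 / 2) (q : ℕ) :
    ‖dirichletCoeff q θ‖ ≤ ((2 : ℝ) ^ q)⁻¹ * (1 / (2 * |θ|)) := by
  unfold dirichletCoeff
  rw [norm_mul, norm_inv, norm_pow, Complex.norm_two]
  exact mul_le_mul_of_nonneg_left (norm_sum_range_eChar_le h0 h1 _) (by positivity)

/-! ### Digit sets supported on the top `σ` digits: the factorisation `ŵ_A = D_q · ŵ_{A'}` -/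

/-- The top-digit part of `A ⊆ {0, …, q+σ-1}`: `A' = {i < σ : q + i ∈ A}` (Bourgain: "`A - λ + σ`").
[cite: Bourgain2013MoebiusWalsh, (1.15)] -/
def topShift (q σ : ℕ) (A : Finset (Fin (q + σ))) : Finset (Fin σ) :=
  Finset.univ.filter fun i => Fin.natAdd q i ∈ A

/-- **Factorisation (1.14)–(1.15)**: if every digit of `A` is `≥ q`, then
`ŵ_A(θ) = D_q(θ) · ŵ_{A'}(2^q θ)`. [cite: Bourgain2013MoebiusWalsh, (1.14)–(1.15)] -/
theorem walshCoeff_eq_dirichletCoeff_mul {q σ : ℕ} (A : Finset (Fin (q + σ)))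
    (hA : ∀ j ∈ A, q ≤ (j : ℕ)) (θ : ℝ) :
    walshCoeff A θ = dirichletCoeff q θ * walshCoeff (topShift q σ A) (2 ^ q * θ) := by
  rw [walshCoeff_eq_prod, Fin.prod_univ_add, ← walshCoeff_empty_eq_dirichletCoeff, walshCoeff_eq_prod,
    walshCoeff_eq_prod]
  congr 1
  · refine Finset.prod_congr rfl fun i _ => ?_
    have hi : Fin.castAdd σ i ∉ A := fun h => by
      have h1 := hA _ h
      have h2 := i.isLt
      simp only [Fin.val_castAdd] at h1
      omega
    rw [if_neg hi, if_neg (Finset.notMem_empty _)]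
    simp
  · refine Finset.prod_congr rfl fun i _ => ?_
    have hmem : (Fin.natAdd q i ∈ A) ↔ i ∈ topShift q σ A := by simp [topShift]
    simp only [Fin.val_natAdd, pow_add]
    by_cases h : i ∈ topShift q σ A
    · rw [if_pos (hmem.2 h), if_pos h]; ring_nf
    · rw [if_neg (fun h' => h (hmem.1 h')), if_neg h]; ring_nf

/-! ### Parseval for Walsh coefficients over a window of integer frequencies -/

/-- Orthogonality over any window of `2ⁿ` consecutive integer frequencies:
`∑_{k ∈ [b, b+2ⁿ)} e(k d/2ⁿ) = 2ⁿ · [2ⁿ ∣ d]`. [folklore] -/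
theorem sum_Ico_eChar_mul_div (n : ℕ) (b d : ℤ) :
    ∑ k ∈ Ico b (b + (2 ^ n : ℕ)), eChar (k * ((d : ℝ) / 2 ^ n)) =
      if (2 ^ n : ℤ) ∣ d then ((2 ^ n : ℕ) : ℂ) else 0 := by
  rw [sum_Ico_int_eq_sum_range]
  have h : ∀ j : ℕ, eChar (((b + (j : ℤ) : ℤ) : ℝ) * ((d : ℝ) / 2 ^ n)) =
      eChar (b * ((d : ℝ) / 2 ^ n)) * eChar (j * ((d : ℝ) / 2 ^ n)) := fun j => by
    rw [← eChar_add]; push_cast; ring_nf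
  simp_rw [h, ← Finset.mul_sum, sum_eChar_mul_div]
  split_ifs with hd
  · obtain ⟨m, rfl⟩ := hd
    rw [show (b : ℝ) * (((2 ^ n * m : ℤ) : ℝ) / 2 ^ n) = ((b * m : ℤ) : ℝ) by push_cast; field_simp,
      eChar_intCast, one_mul]
  · rw [mul_zero]

/-- The diagonal evaluation behind Parseval: `∑_x ∑_y w(x) w(y) 2ⁿ[x = y] = 2ⁿ · 2ⁿ`. [folklore] -/
theorem sum_sum_walshSign_mul_ite {n : ℕ} (B : Finset (Fin n)) :
    ∑ x : Fin n → Bool, ∑ y : Fin n → Bool, (walshSign B x : ℂ) * (walshSign B y : ℂ) *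
      (if (2 ^ n : ℤ) ∣ ((bitsToNat (List.ofFn x) : ℤ) - (bitsToNat (List.ofFn y) : ℤ))
        then ((2 ^ n : ℕ) : ℂ) else 0) = (2 : ℂ) ^ n * (2 : ℂ) ^ n := by
  classical
  have hsq : ∀ x : Fin n → Bool, (walshSign B x : ℂ) * (walshSign B x : ℂ) = 1 := fun x => by
    rw [← Complex.ofReal_mul, ← sq, ← abs_sq, abs_pow, abs_walshSign, one_pow, Complex.ofReal_one]
  have hinner : ∀ x : Fin n → Bool, ∑ y : Fin n → Bool, (walshSign B x : ℂ) * (walshSign B y : ℂ) *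
      (if (2 ^ n : ℤ) ∣ ((bitsToNat (List.ofFn x) : ℤ) - (bitsToNat (List.ofFn y) : ℤ))
        then ((2 ^ n : ℕ) : ℂ) else 0) = (2 : ℂ) ^ n := by
    intro x
    rw [Finset.sum_eq_single x]
    · rw [if_pos (by simp), hsq, one_mul]; push_cast; ring
    · intro y _ hyx
      rw [if_neg (fun h => hyx ((two_pow_dvd_sub_iff y x).1 h).symm), mul_zero]
    · intro h; exact absurd (Finset.mem_univ x) h
  rw [Finset.sum_congr rfl fun x _ => hinner x, Finset.sum_const, Finset.card_univ, Fintype.card_fun,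
    Fintype.card_bool, Fintype.card_fin, nsmul_eq_mul]
  push_cast
  ring

/-- `conj ŵ_B(θ) = ŵ_B(-θ)` (the Walsh function is real). [folklore] -/
theorem conj_walshCoeff {n : ℕ} (B : Finset (Fin n)) (θ : ℝ) :
    starRingEnd ℂ (walshCoeff B θ) = walshCoeff B (-θ) := by
  unfold walshCoeff
  rw [map_mul, map_inv₀, map_pow, Complex.conj_ofNat, map_sum]
  congr 1
  refine Finset.sum_congr rfl fun x _ => ?_
  rw [map_mul, Complex.conj_ofReal, conj_eChar, neg_mul]

/-- **Parseval** for the Walsh function `w_B` on `ℤ/2ⁿℤ`, over any window of `2ⁿ` consecutive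
integer frequencies: `∑_{k ∈ [b, b + 2ⁿ)} |ŵ_B(k/2ⁿ)|² = 2⁻ⁿ ∑_x w_B(x)² = 1`. [folklore] -/
theorem sum_Ico_norm_sq_walshCoeff {n : ℕ} (B : Finset (Fin n)) (b : ℤ) :
    ∑ k ∈ Ico b (b + (2 ^ n : ℕ)), ‖walshCoeff B ((k : ℝ) / 2 ^ n)‖ ^ 2 = 1 := by
  classical
  have hterm : ∀ k : ℤ, walshCoeff B ((k : ℝ) / 2 ^ n) * walshCoeff B (-((k : ℝ) / 2 ^ n)) =
      ((2 : ℂ) ^ n)⁻¹ * ((2 : ℂ) ^ n)⁻¹ * ∑ x : Fin n → Bool, ∑ y : Fin n → Bool,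
        (walshSign B x : ℂ) * (walshSign B y : ℂ) *
          eChar (k * ((((bitsToNat (List.ofFn x) : ℤ) - (bitsToNat (List.ofFn y) : ℤ) : ℤ) : ℝ) /
            2 ^ n)) := by
    intro k
    unfold walshCoeff
    rw [show ∀ a c : ℂ, ((2 : ℂ) ^ n)⁻¹ * a * (((2 : ℂ) ^ n)⁻¹ * c) =
        ((2 : ℂ) ^ n)⁻¹ * ((2 : ℂ) ^ n)⁻¹ * (a * c) from fun a c => by ring, Finset.sum_mul_sum]
    congr 1
    refine Finset.sum_congr rfl fun x _ => Finset.sum_congr rfl fun y _ => ?_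
    rw [show ∀ a c d f : ℂ, a * c * (d * f) = a * d * (c * f) from fun a c d f => by ring, ← eChar_add]
    congr 2
    push_cast
    ring
  have hswap : ∑ k ∈ Ico b (b + (2 ^ n : ℕ)), ∑ x : Fin n → Bool, ∑ y : Fin n → Bool,
      (walshSign B x : ℂ) * (walshSign B y : ℂ) *
        eChar (k * ((((bitsToNat (List.ofFn x) : ℤ) - (bitsToNat (List.ofFn y) : ℤ) : ℤ) : ℝ) / 2 ^ n)) =
      ∑ x : Fin n → Bool, ∑ y : Fin n → Bool, (walshSign B x : ℂ) * (walshSign B y : ℂ) *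
        (if (2 ^ n : ℤ) ∣ ((bitsToNat (List.ofFn x) : ℤ) - (bitsToNat (List.ofFn y) : ℤ))
          then ((2 ^ n : ℕ) : ℂ) else 0) := by
    rw [Finset.sum_comm]
    refine Finset.sum_congr rfl fun x _ => ?_
    rw [Finset.sum_comm]
    refine Finset.sum_congr rfl fun y _ => ?_
    rw [← Finset.mul_sum, sum_Ico_eChar_mul_div]
  have hC : (∑ k ∈ Ico b (b + (2 ^ n : ℕ)), (‖walshCoeff B ((k : ℝ) / 2 ^ n)‖ ^ 2 : ℝ) : ℂ) = 1 := by
    simp_rw [Complex.sq_norm, ← Complex.mul_conj, conj_walshCoeff, hterm, ← Finset.mul_sum]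
    rw [hswap, sum_sum_walshSign_mul_ite]
    have h2 : (2 : ℂ) ^ n ≠ 0 := pow_ne_zero _ two_ne_zero
    field_simp
  exact_mod_cast hC

/-! ### The Walsh function read on natural numbers, and Fourier inversion over a window -/

/-- The Walsh function `w_A` read on a natural number through its binary digits:
`w_A(x) = ∏_{j ∈ A} (1 - 2 x_j)`, `x_j = bit_j(x)`; it is `2ⁿ`-periodic (`walshNat_add_two_pow`).
[cite: Bourgain2013MoebiusWalsh, (0.1)] -/
def walshNat {n : ℕ} (A : Finset (Fin n)) (x : ℕ) : ℝ := walshSign A fun j => x.testBit j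

/-- `w_A(x) = ∏_{j ∈ A} (−1)^{bit_j(x)}` explicitly. [folklore] -/
theorem walshNat_eq_prod {n : ℕ} (A : Finset (Fin n)) (x : ℕ) :
    walshNat A x = ∏ j ∈ A, (if x.testBit j = true then (-1 : ℝ) else 1) := rfl

/-- `|w_A(x)| = 1`. [folklore] -/
theorem abs_walshNat {n : ℕ} (A : Finset (Fin n)) (x : ℕ) : |walshNat A x| = 1 := abs_walshSign _ _

/-- `w_A(x)` only depends on `x mod 2ⁿ`. [folklore] -/
theorem walshNat_mod_two_pow {n : ℕ} (A : Finset (Fin n)) (x : ℕ) :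
    walshNat A (x % 2 ^ n) = walshNat A x := by
  unfold walshNat
  congr 1
  funext j
  rw [Nat.testBit_mod_two_pow]
  simp [j.isLt]

/-- `w_A` is `2ⁿ`-periodic. [folklore] -/
theorem walshNat_add_two_pow {n : ℕ} (A : Finset (Fin n)) (x : ℕ) :
    walshNat A (x + 2 ^ n) = walshNat A x := by
  rw [← walshNat_mod_two_pow A (x + 2 ^ n), Nat.add_mod_right, walshNat_mod_two_pow]

/-- On a digit vector, `walshNat` is `walshSign`. [folklore] -/
theorem walshNat_bitsToNat {n : ℕ} (A : Finset (Fin n)) (y : Fin n → Bool) :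
    walshNat A (bitsToNat (List.ofFn y)) = walshSign A y := by
  unfold walshNat
  rw [Literature.NumberTheory.Sieve.MoebiusWalsh.ofFn_testBit_bitsToNat]

/-- `ŵ_A(θ + m) = ŵ_A(θ)` for an integer `m`. [folklore] -/
theorem walshCoeff_add_int {n : ℕ} (A : Finset (Fin n)) (θ : ℝ) (m : ℤ) :
    walshCoeff A (θ + m) = walshCoeff A θ := by
  unfold walshCoeff
  congr 1
  refine Finset.sum_congr rfl fun x _ => ?_
  rw [add_mul, show (m : ℝ) * (bitsToNat (List.ofFn x) : ℕ) = ((m * (bitsToNat (List.ofFn x) : ℕ) : ℤ) : ℝ)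
    by push_cast; ring, eChar_add_intCast]

/-- **Fourier inversion on `ℤ/2ⁿℤ`, read on natural numbers** (Bourgain 2013, Lemma 1):
`w_A(x) = ∑_{k < 2ⁿ} ŵ_A(k/2ⁿ) e(−kx/2ⁿ)` for every `x ∈ ℕ`. [cite: Bourgain2013MoebiusWalsh, Lemma 1] -/
theorem walshNat_eq_sum_range {n : ℕ} (A : Finset (Fin n)) (x : ℕ) :
    (walshNat A x : ℂ) = ∑ k ∈ range (2 ^ n),
      walshCoeff A ((k : ℝ) / 2 ^ n) * eChar (-(k * ((x : ℝ) / 2 ^ n))) := by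
  set x₀ := x % 2 ^ n with hx₀
  have hlt : x₀ < 2 ^ n := Nat.mod_lt _ (Nat.two_pow_pos n)
  have hchar : ∀ k : ℕ, eChar (-(k * ((x : ℝ) / 2 ^ n))) = eChar (-(k * ((x₀ : ℝ) / 2 ^ n))) := by
    intro k
    obtain ⟨d, hd⟩ : ∃ d : ℕ, x = 2 ^ n * d + x₀ := ⟨x / 2 ^ n, (Nat.div_add_mod x (2 ^ n)).symm⟩
    have h1 : -((k : ℝ) * ((x : ℝ) / 2 ^ n)) =
        -(k * ((x₀ : ℝ) / 2 ^ n)) + (((-((k * d : ℕ) : ℤ)) : ℤ) : ℝ) := by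
      rw [hd]; push_cast; field_simp; ring
    rw [h1, eChar_add_intCast]
  simp_rw [hchar]
  rw [← walshNat_mod_two_pow, ← hx₀]
  have h := walshSign_eq_sum_walshCoeff A (fun j : Fin n => x₀.testBit j)
  rw [Literature.NumberTheory.Sieve.MoebiusWalsh.bitsToNat_ofFn_testBit hlt] at h
  exact h

/-- **Fourier inversion over a window of integer frequencies**: for every `m`,
`w_A(x) = ∑_{-m ≤ k < -m + 2ⁿ} ŵ_A(k/2ⁿ) e(−kx/2ⁿ)` (`x ∈ ℕ`). [cite: Bourgain2013MoebiusWalsh, Lemma 1] -/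
theorem walshNat_eq_sum_Ico {n : ℕ} (A : Finset (Fin n)) (x m : ℕ) :
    (walshNat A x : ℂ) = ∑ k ∈ Ico (-(m : ℤ)) (-(m : ℤ) + (2 ^ n : ℕ)),
      walshCoeff A ((k : ℝ) / 2 ^ n) * eChar (-(k * ((x : ℝ) / 2 ^ n))) := by
  have hper : ∀ k : ℤ, walshCoeff A (((k + (2 ^ n : ℕ) : ℤ) : ℝ) / 2 ^ n) *
      eChar (-(((k + (2 ^ n : ℕ) : ℤ) : ℝ) * ((x : ℝ) / 2 ^ n))) =
      walshCoeff A ((k : ℝ) / 2 ^ n) * eChar (-(k * ((x : ℝ) / 2 ^ n))) := by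
    intro k
    congr 1
    · rw [show (((k + (2 ^ n : ℕ) : ℤ) : ℝ) / 2 ^ n) = (k : ℝ) / 2 ^ n + ((1 : ℤ) : ℝ) by
        push_cast; field_simp, walshCoeff_add_int]
    · rw [show -(((k + (2 ^ n : ℕ) : ℤ) : ℝ) * ((x : ℝ) / 2 ^ n)) =
        -(k * ((x : ℝ) / 2 ^ n)) + ((-(x : ℤ) : ℤ) : ℝ) by push_cast; field_simp; ring, eChar_add_intCast]
  have h := sum_Ico_int_eq_of_periodic (f := fun k : ℤ => walshCoeff A ((k : ℝ) / 2 ^ n) *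
    eChar (-(k * ((x : ℝ) / 2 ^ n)))) hper 0 m
  rw [zero_sub] at h
  rw [h, sum_Ico_int_eq_sum_range, walshNat_eq_sum_range]
  refine Finset.sum_congr rfl fun j _ => ?_
  push_cast
  ring_nf

/-! ### Parseval for trigonometric polynomials with frequencies in a window -/

/-- For `k, k'` in a window of length `2ⁿ`, `2ⁿ ∣ k' - k` iff `k = k'`. [folklore] -/
theorem two_pow_dvd_sub_iff_of_mem_Ico {n : ℕ} {b k k' : ℤ} (hk : k ∈ Ico b (b + (2 ^ n : ℕ)))
    (hk' : k' ∈ Ico b (b + (2 ^ n : ℕ))) : (2 ^ n : ℤ) ∣ (k' - k) ↔ k = k' := by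
  rw [Finset.mem_Ico] at hk hk'
  constructor
  · intro h
    have hlt : |k' - k| < (2 ^ n : ℤ) := by
      rw [abs_lt]; push_cast at hk hk' ⊢; constructor <;> omega
    have := Int.eq_zero_of_abs_lt_dvd h hlt
    omega
  · rintro rfl; simp

/-- **Parseval for a trigonometric polynomial** `T(x) = ∑_{k ∈ [b, b+2ⁿ)} a_k e(−kx/2ⁿ)`:
`∑_{x < 2ⁿ} |T(x)|² = 2ⁿ ∑_k |a_k|²`. [folklore] -/
theorem sum_norm_sq_trigPoly (n : ℕ) (b : ℤ) (a : ℤ → ℂ) :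
    ∑ x ∈ range (2 ^ n), ‖∑ k ∈ Ico b (b + (2 ^ n : ℕ)), a k * eChar (-(k * ((x : ℝ) / 2 ^ n)))‖ ^ 2 =
      2 ^ n * ∑ k ∈ Ico b (b + (2 ^ n : ℕ)), ‖a k‖ ^ 2 := by
  set I := Ico b (b + (2 ^ n : ℕ)) with hI
  have hC : ∀ x : ℕ, ((‖∑ k ∈ I, a k * eChar (-(k * ((x : ℝ) / 2 ^ n)))‖ ^ 2 : ℝ) : ℂ) =
      ∑ k ∈ I, ∑ k' ∈ I, a k * starRingEnd ℂ (a k') *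
        eChar (x * ((((k' - k : ℤ)) : ℝ) / 2 ^ n)) := by
    intro x
    rw [Complex.sq_norm, ← Complex.mul_conj, map_sum, Finset.sum_mul_sum]
    refine Finset.sum_congr rfl fun k _ => Finset.sum_congr rfl fun k' _ => ?_
    rw [map_mul, conj_eChar, neg_neg]
    rw [show ∀ p q r s : ℂ, p * q * (r * s) = p * r * (q * s) from fun p q r s => by ring, ← eChar_add]
    congr 2; push_cast; ring
  have hsum : (∑ x ∈ range (2 ^ n), ((‖∑ k ∈ I, a k * eChar (-(k * ((x : ℝ) / 2 ^ n)))‖ ^ 2 : ℝ) : ℂ)) =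
      ((2 ^ n * ∑ k ∈ I, ‖a k‖ ^ 2 : ℝ) : ℂ) := by
    simp_rw [hC]
    rw [Finset.sum_comm]
    simp_rw [Finset.sum_comm (s := range (2 ^ n)) (t := I), ← Finset.mul_sum, sum_eChar_mul_div]
    push_cast
    rw [Finset.mul_sum]
    refine Finset.sum_congr rfl fun k hk => ?_
    rw [Finset.sum_eq_single k]
    · rw [if_pos (by simp), Complex.mul_conj']; ring
    · intro k' hk' hne
      rw [if_neg (fun h => hne ((two_pow_dvd_sub_iff_of_mem_Ico hk hk').1 h).symm), mul_zero]
    · intro h; exact absurd hk h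
  exact_mod_cast hsum

/-! ### Fejér sums and the de la Vallée-Poussin (trapezoid) multiplier -/

/-- The Fejér sum `Φ_M(θ) = |∑_{j<M} e(jθ)|² ≥ 0`. [folklore] -/
def fejerSum (M : ℕ) (θ : ℝ) : ℝ := ‖∑ j ∈ range M, eChar (θ * j)‖ ^ 2

/-- `Φ_M ≥ 0`. [folklore] -/
theorem fejerSum_nonneg (M : ℕ) (θ : ℝ) : 0 ≤ fejerSum M θ := sq_nonneg _

/-- `Φ_M(θ) = ∑_{j, j' < M} e((j - j')θ)` in `ℂ`. [folklore] -/
theorem fejerSum_eq_sum_sum (M : ℕ) (θ : ℝ) :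
    (fejerSum M θ : ℂ) = ∑ j ∈ range M, ∑ j' ∈ range M, eChar (θ * (((j : ℤ) - (j' : ℤ) : ℤ) : ℝ)) := by
  unfold fejerSum
  rw [Complex.ofReal_pow, ← Complex.mul_conj', map_sum, Finset.sum_mul_sum]
  refine Finset.sum_congr rfl fun j _ => Finset.sum_congr rfl fun j' _ => ?_
  rw [conj_eChar, ← eChar_add]
  congr 1; push_cast; ring

/-- The number of pairs `(j, j') ∈ [0, M)²` with `j - j' = k` is `M - |k|` (truncated subtraction).
[folklore] -/
theorem card_filter_sub_eq (M : ℕ) (k : ℤ) :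
    ((range M ×ˢ range M).filter fun p : ℕ × ℕ => (p.1 : ℤ) - p.2 = k).card = M - k.natAbs := by
  rcases le_or_gt 0 k with hk | hk
  · -- `k ≥ 0`: the pairs are `(j' + k, j')`, `j' < M - k`
    obtain ⟨c, rfl⟩ := Int.eq_ofNat_of_zero_le hk
    rw [Int.natAbs_natCast]
    have h : ((range M ×ˢ range M).filter fun p : ℕ × ℕ => (p.1 : ℤ) - p.2 = (c : ℤ)) =
        (range (M - c)).image fun j' => (j' + c, j') := by
      ext ⟨u, v⟩
      simp only [Finset.mem_filter, Finset.mem_product, Finset.mem_range, Finset.mem_image, Prod.mk.injEq]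
      constructor
      · rintro ⟨⟨hu, hv⟩, huv⟩
        exact ⟨v, by omega, by omega, rfl⟩
      · rintro ⟨j', hj', rfl, rfl⟩
        exact ⟨⟨by omega, by omega⟩, by push_cast; ring⟩
    rw [h, Finset.card_image_of_injective _ (fun a b hab => by simpa using congrArg Prod.snd hab),
      Finset.card_range]
  · -- `k < 0`: the pairs are `(j, j + |k|)`, `j < M - |k|`
    obtain ⟨c, hc⟩ := Int.exists_eq_neg_ofNat (le_of_lt hk)
    subst hc
    rw [Int.natAbs_neg, Int.natAbs_natCast]
    have h : ((range M ×ˢ range M).filter fun p : ℕ × ℕ => (p.1 : ℤ) - p.2 = -(c : ℤ)) =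
        (range (M - c)).image fun j => (j, j + c) := by
      ext ⟨u, v⟩
      simp only [Finset.mem_filter, Finset.mem_product, Finset.mem_range, Finset.mem_image, Prod.mk.injEq]
      constructor
      · rintro ⟨⟨hu, hv⟩, huv⟩
        exact ⟨u, by omega, rfl, by omega⟩
      · rintro ⟨j, hj, rfl, rfl⟩
        exact ⟨⟨by omega, by omega⟩, by push_cast; ring⟩
    rw [h, Finset.card_image_of_injective _ (fun a b hab => by simpa using congrArg Prod.fst hab),
      Finset.card_range]

/-- **Fejér's expansion**: `Φ_M(θ) = ∑_{|k| < L} (M - |k|)₊ e(kθ)` for any `L ≥ M` (the weights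
vanish for `|k| ≥ M`). [folklore] -/
theorem fejerSum_eq_sum_Ioo {M L : ℕ} (hML : M ≤ L) (θ : ℝ) :
    (fejerSum M θ : ℂ) = ∑ k ∈ Ioo (-(L : ℤ)) L, ((M - k.natAbs : ℕ) : ℂ) * eChar (θ * k) := by
  rw [fejerSum_eq_sum_sum, ← Finset.sum_product']
  symm
  rw [← Finset.sum_fiberwise_of_maps_to (s := range M ×ˢ range M) (t := Ioo (-(L : ℤ)) L)
    (g := fun p : ℕ × ℕ => (p.1 : ℤ) - p.2)]
  · refine Finset.sum_congr rfl fun k _ => ?_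
    rw [Finset.sum_congr rfl (g := fun _ : ℕ × ℕ => eChar (θ * k)) fun p hp => by
      rw [Finset.mem_filter] at hp; rw [hp.2], Finset.sum_const, card_filter_sub_eq, nsmul_eq_mul]
  · intro p hp
    rw [Finset.mem_product, Finset.mem_range, Finset.mem_range] at hp
    rw [Finset.mem_Ioo]
    constructor <;> omega

/-- The trapezoid (de la Vallée-Poussin) multiplier of width `N`:
`η_N(k) = ((2N - |k|)₊ - (N - |k|)₊)/N`, equal to `1` for `|k| ≤ N`, to `2 - |k|/N` for
`N ≤ |k| ≤ 2N`, and to `0` beyond (Bourgain 2013, (1.22): "`η` trapezoidal with `η(z) = 1` for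
`|z| < K₁2^σ`, `η(z) = 0` for `|z| ≥ 2K₁2^σ`"). [cite: Bourgain2013MoebiusWalsh, (1.22)] -/
def trapezoid (N : ℕ) (k : ℤ) : ℝ := (((2 * N - k.natAbs : ℕ) : ℝ) - ((N - k.natAbs : ℕ) : ℝ)) / N

/-- `η_N(k) = 1` for `|k| ≤ N`. [folklore] -/
theorem trapezoid_eq_one {N : ℕ} (hN : 0 < N) {k : ℤ} (hk : k.natAbs ≤ N) : trapezoid N k = 1 := by
  unfold trapezoid
  rw [div_eq_one_iff_eq (by exact_mod_cast hN.ne'), Nat.cast_sub (by omega), Nat.cast_sub hk]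
  push_cast; ring

/-- `0 ≤ η_N ≤ 1`. [folklore] -/
theorem trapezoid_mem_Icc (N : ℕ) (k : ℤ) : trapezoid N k ∈ Set.Icc (0 : ℝ) 1 := by
  unfold trapezoid
  rcases Nat.eq_zero_or_pos N with rfl | hN
  · simp
  have hNr : (0 : ℝ) < N := by exact_mod_cast hN
  constructor
  · apply div_nonneg _ hNr.le
    rw [sub_nonneg]
    exact_mod_cast (Nat.sub_le_sub_right (by omega) _)
  · rw [div_le_one hNr, sub_le_iff_le_add]
    rcases le_or_gt k.natAbs N with h | h
    · rw [Nat.cast_sub (by omega), Nat.cast_sub h]; push_cast; linarith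
    · rw [Nat.sub_eq_zero_of_le h.le]
      have : ((2 * N - k.natAbs : ℕ) : ℝ) ≤ N := by exact_mod_cast (by omega : 2 * N - k.natAbs ≤ N)
      push_cast at this ⊢; linarith

/-- `|η_N| ≤ 1`. [folklore] -/
theorem abs_trapezoid_le (N : ℕ) (k : ℤ) : |trapezoid N k| ≤ 1 :=
  abs_le.2 ⟨by linarith [(trapezoid_mem_Icc N k).1], (trapezoid_mem_Icc N k).2⟩

/-- `(1 - η_N(k))² ≤ 1`, with equality to `0` when `|k| ≤ N`. [folklore] -/
theorem sq_one_sub_trapezoid_le (N : ℕ) (k : ℤ) : (1 - trapezoid N k) ^ 2 ≤ 1 := by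
  have h := trapezoid_mem_Icc N k
  nlinarith [h.1, h.2]

/-- `η_N(k) = 0` for `|k| ≥ 2N`. [folklore] -/
theorem trapezoid_eq_zero {N : ℕ} {k : ℤ} (hk : 2 * N ≤ k.natAbs) : trapezoid N k = 0 := by
  unfold trapezoid
  rw [Nat.sub_eq_zero_of_le hk, Nat.sub_eq_zero_of_le (by omega)]
  simp

/-- The de la Vallée-Poussin kernel `V_N(θ) = ∑_{|k| < 2N} η_N(k) e(kθ) = (Φ_{2N}(θ) - Φ_N(θ))/N`.
[folklore] -/
theorem sum_trapezoid_mul_eChar {N : ℕ} (hN : 0 < N) (θ : ℝ) :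
    ∑ k ∈ Ioo (-((2 * N : ℕ) : ℤ)) ((2 * N : ℕ) : ℤ), (trapezoid N k : ℂ) * eChar (θ * k) =
      ((fejerSum (2 * N) θ - fejerSum N θ) / N : ℝ) := by
  push_cast
  rw [fejerSum_eq_sum_Ioo (le_refl (2 * N)), fejerSum_eq_sum_Ioo (by omega : N ≤ 2 * N),
    ← Finset.sum_sub_distrib, Finset.sum_div]
  push_cast
  refine Finset.sum_congr rfl fun k _ => ?_
  unfold trapezoid
  push_cast
  ring

/-- **Mean of a Fejér sum over a period**: `∑_{y < 2ⁿ} Φ_M((y - x)/2ⁿ) = 2ⁿ M` for `M ≤ 2ⁿ` and any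
integer `x` (only the diagonal `j = j'` survives the `y`-average). [folklore] -/
theorem sum_fejerSum_sub_div (n : ℕ) {M : ℕ} (hM : M ≤ 2 ^ n) (x : ℤ) :
    ∑ y ∈ range (2 ^ n), fejerSum M ((((y : ℤ) - x : ℤ) : ℝ) / 2 ^ n) = 2 ^ n * M := by
  have hC : ∀ y : ℕ, (fejerSum M ((((y : ℤ) - x : ℤ) : ℝ) / 2 ^ n) : ℂ) =
      ∑ j ∈ range M, ∑ j' ∈ range M, eChar (-(x * ((((j : ℤ) - j' : ℤ) : ℝ) / 2 ^ n))) *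
        eChar (y * ((((j : ℤ) - j' : ℤ) : ℝ) / 2 ^ n)) := by
    intro y
    rw [fejerSum_eq_sum_sum]
    refine Finset.sum_congr rfl fun j _ => Finset.sum_congr rfl fun j' _ => ?_
    rw [← eChar_add]; congr 1; push_cast; ring
  have hsum : ((∑ y ∈ range (2 ^ n), fejerSum M ((((y : ℤ) - x : ℤ) : ℝ) / 2 ^ n) : ℝ) : ℂ) =
      ((2 ^ n * M : ℕ) : ℂ) := by
    rw [Complex.ofReal_sum]
    simp_rw [hC]
    rw [Finset.sum_comm]
    simp_rw [Finset.sum_comm (s := range (2 ^ n)) (t := range M), ← Finset.mul_sum, sum_eChar_mul_div]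
    have hdiag : ∀ j ∈ range M, ∑ j' ∈ range M, eChar (-(x * ((((j : ℤ) - j' : ℤ) : ℝ) / 2 ^ n))) *
        (if (2 ^ n : ℤ) ∣ ((j : ℤ) - j') then ((2 ^ n : ℕ) : ℂ) else 0) = ((2 ^ n : ℕ) : ℂ) := by
      intro j hj
      rw [Finset.sum_eq_single j]
      · rw [if_pos (by simp), sub_self]; simp
      · intro j' hj' hne
        rw [Finset.mem_range] at hj hj'
        rw [if_neg, mul_zero]
        intro hd
        have hlt : |(j : ℤ) - j'| < ((2 ^ n : ℕ) : ℤ) := by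
          rw [abs_lt]; constructor <;> omega
        have hlt' : |(j : ℤ) - j'| < (2 ^ n : ℤ) := by exact_mod_cast hlt
        have := Int.eq_zero_of_abs_lt_dvd hd hlt'
        omega
      · intro h; exact absurd hj h
    rw [Finset.sum_congr rfl hdiag, Finset.sum_const, Finset.card_range, nsmul_eq_mul]
    push_cast; ring
  exact_mod_cast hsum

/-- `∑_{i < L} 1/(K + i)² ≤ 1/(K - 1)` for `K ≥ 2` (telescoping). [folklore] -/
theorem sum_range_one_div_sq_le {K : ℕ} (hK : 2 ≤ K) (L : ℕ) :
    ∑ i ∈ range L, 1 / (((K + i : ℕ) : ℝ)) ^ 2 ≤ 1 / ((K : ℝ) - 1) := by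
  have hK1 : (1 : ℝ) < K := by exact_mod_cast hK
  have key : ∀ L : ℕ, ∑ i ∈ range L, 1 / (((K + i : ℕ) : ℝ)) ^ 2 ≤
      1 / ((K : ℝ) - 1) - 1 / ((K : ℝ) + L - 1) := by
    intro L
    induction L with
    | zero => simp
    | succ L ih =>
      rw [Finset.sum_range_succ]
      have hpos : (0 : ℝ) < (K : ℝ) + L - 1 := by linarith
      have hstep : 1 / (((K + L : ℕ) : ℝ)) ^ 2 ≤ 1 / ((K : ℝ) + L - 1) - 1 / ((K : ℝ) + (L + 1 : ℕ) - 1) := by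
        rw [div_sub_div _ _ hpos.ne' (by push_cast; linarith), div_le_div_iff₀ (by positivity)
          (mul_pos hpos (by push_cast; linarith))]
        push_cast; nlinarith
      calc _ ≤ 1 / ((K : ℝ) - 1) - 1 / ((K : ℝ) + L - 1) + (1 / ((K : ℝ) + L - 1) -
            1 / ((K : ℝ) + (L + 1 : ℕ) - 1)) := add_le_add ih hstep
        _ = _ := by ring
  exact (key L).trans (sub_le_self _ (div_nonneg zero_le_one (by linarith)))

/-! ### The localised substitute `W_A` (Bourgain 2013, Lemma 5, (1.12)–(1.13), (1.22)) -/

section Localised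

variable (q σ K₁ : ℕ) (A : Finset (Fin (q + σ)))

/-- The Fourier coefficients of `W_A`: `Ŵ_A(k) = η(k) ŵ_A(k/2^{q+σ})` with the trapezoid `η` of
width `N = K₁ 2^σ` (Bourgain 2013, (1.22)). [cite: Bourgain2013MoebiusWalsh, (1.22)] -/
def localisedCoeff (k : ℤ) : ℂ :=
  (trapezoid (K₁ * 2 ^ σ) k : ℂ) * walshCoeff A ((k : ℝ) / 2 ^ (q + σ))

/-- **Bourgain's `W_A`** (2013, (1.22)): the trigonometric polynomial
`W_A(x) = ∑_{|k| < 2N} η(k) ŵ_A(k/P) e(-kx/P)`, `P = 2^{q+σ}`, `N = K₁ 2^σ`, read on natural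
numbers `x`. [cite: Bourgain2013MoebiusWalsh, (1.22)] -/
def localisedWalsh (x : ℕ) : ℂ :=
  ∑ k ∈ Ioo (-((2 * (K₁ * 2 ^ σ) : ℕ) : ℤ)) ((2 * (K₁ * 2 ^ σ) : ℕ) : ℤ),
    localisedCoeff q σ K₁ A k * eChar (-(k * ((x : ℝ) / 2 ^ (q + σ))))

/-- **(1.13), first half**: `|Ŵ_A(k)| ≤ |ŵ_A(k)|`. [cite: Bourgain2013MoebiusWalsh, Lemma 5 (1.13)] -/
theorem norm_localisedCoeff_le (k : ℤ) :
    ‖localisedCoeff q σ K₁ A k‖ ≤ ‖walshCoeff A ((k : ℝ) / 2 ^ (q + σ))‖ := by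
  unfold localisedCoeff
  rw [norm_mul, Complex.norm_real, Real.norm_eq_abs]
  exact mul_le_of_le_one_left (norm_nonneg _) (abs_trapezoid_le _ _)

/-- `Ŵ_A(k) = ŵ_A(k)` for `|k| ≤ N = K₁ 2^σ`. [cite: Bourgain2013MoebiusWalsh, (1.22)] -/
theorem localisedCoeff_eq_walshCoeff {K₁ σ : ℕ} (q : ℕ) (A : Finset (Fin (q + σ))) (hK : 0 < K₁) {k : ℤ}
    (hk : k.natAbs ≤ K₁ * 2 ^ σ) :
    localisedCoeff q σ K₁ A k = walshCoeff A ((k : ℝ) / 2 ^ (q + σ)) := by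
  unfold localisedCoeff
  rw [trapezoid_eq_one (Nat.mul_pos hK (Nat.two_pow_pos σ)) hk, Complex.ofReal_one, one_mul]

/-- **(1.13), second half**: `Ŵ_A(k) = 0` for `|k| ≥ 2N = 2K₁2^σ`. [cite: Bourgain2013MoebiusWalsh, Lemma 5 (1.13)] -/
theorem localisedCoeff_eq_zero {q σ K₁ : ℕ} (A : Finset (Fin (q + σ))) {k : ℤ}
    (hk : 2 * (K₁ * 2 ^ σ) ≤ k.natAbs) : localisedCoeff q σ K₁ A k = 0 := by
  unfold localisedCoeff
  rw [trapezoid_eq_zero hk, Complex.ofReal_zero, zero_mul]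

/-- `W_A` is `2^{q+σ}`-periodic. [folklore] -/
theorem localisedWalsh_add_two_pow (x : ℕ) :
    localisedWalsh q σ K₁ A (x + 2 ^ (q + σ)) = localisedWalsh q σ K₁ A x := by
  unfold localisedWalsh
  refine Finset.sum_congr rfl fun k _ => ?_
  rw [show -((k : ℝ) * (((x + 2 ^ (q + σ) : ℕ) : ℝ) / 2 ^ (q + σ))) =
    -(k * ((x : ℝ) / 2 ^ (q + σ))) + ((-k : ℤ) : ℝ) by push_cast; field_simp; ring, eChar_add_intCast]

/-- `ŵ_A(θ) = 2^{-n} ∑_{y < 2ⁿ} w_A(y) e(θ y)` with the Walsh function read on naturals. [folklore] -/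
theorem walshCoeff_eq_sum_range_walshNat {n : ℕ} (B : Finset (Fin n)) (θ : ℝ) :
    walshCoeff B θ = ((2 : ℂ) ^ n)⁻¹ * ∑ y ∈ range (2 ^ n), (walshNat B y : ℂ) * eChar (θ * y) := by
  unfold walshCoeff
  congr 1
  rw [← sum_digits_eq_sum_range n (fun m => (walshNat B m : ℂ) * eChar (θ * m))]
  refine Finset.sum_congr rfl fun y _ => ?_
  rw [walshNat_bitsToNat]

/-- **`W_A` is a de la Vallée-Poussin mean of `w_A`**:
`W_A(x) = 2^{-(q+σ)} ∑_{y < P} w_A(y) V((y - x)/P)`, `V = (Φ_{2N} - Φ_N)/N`. [folklore] -/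
theorem localisedWalsh_eq_sum_fejer {K₁ : ℕ} (hK : 0 < K₁) (q σ : ℕ) (A : Finset (Fin (q + σ))) (x : ℕ) :
    localisedWalsh q σ K₁ A x = ((2 : ℂ) ^ (q + σ))⁻¹ * ∑ y ∈ range (2 ^ (q + σ)), (walshNat A y : ℂ) *
      (((fejerSum (2 * (K₁ * 2 ^ σ)) ((((y : ℤ) - x : ℤ) : ℝ) / 2 ^ (q + σ)) -
        fejerSum (K₁ * 2 ^ σ) ((((y : ℤ) - x : ℤ) : ℝ) / 2 ^ (q + σ))) / (K₁ * 2 ^ σ : ℕ) : ℝ) : ℂ) := by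
  have hN : 0 < K₁ * 2 ^ σ := Nat.mul_pos hK (Nat.two_pow_pos σ)
  set θ : ℕ → ℝ := fun y => (((y : ℤ) - x : ℤ) : ℝ) / 2 ^ (q + σ) with hθ
  simp_rw [← sum_trapezoid_mul_eChar hN]
  unfold localisedWalsh localisedCoeff
  simp_rw [walshCoeff_eq_sum_range_walshNat A, Finset.mul_sum, Finset.sum_mul]
  rw [Finset.sum_comm]
  refine Finset.sum_congr rfl fun y _ => Finset.sum_congr rfl fun k _ => ?_
  have harg : (k : ℝ) / 2 ^ (q + σ) * (y : ℕ) + -((k : ℝ) * ((x : ℝ) / 2 ^ (q + σ))) = θ y * k := by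
    rw [hθ]; push_cast; ring
  rw [show ∀ a b c d e : ℂ, a * (b * (c * d)) * e = b * (c * (a * (d * e))) from fun a b c d e => by ring,
    ← eChar_add, harg]

/-- **(1.22): "`‖W_A‖_∞ ≤ 3`"** — for `2N ≤ P` (`N = K₁2^σ`, `P = 2^{q+σ}`), `|W_A(x)| ≤ 3` for every
`x`, since `|V| ≤ (Φ_{2N} + Φ_N)/N` has mean `3`. [cite: Bourgain2013MoebiusWalsh, Lemma 5 (1.22)] -/
theorem norm_localisedWalsh_le {q σ K₁ : ℕ} (hK : 0 < K₁) (h2N : 2 * (K₁ * 2 ^ σ) ≤ 2 ^ (q + σ))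
    (A : Finset (Fin (q + σ))) (x : ℕ) : ‖localisedWalsh q σ K₁ A x‖ ≤ 3 := by
  have hN : 0 < K₁ * 2 ^ σ := Nat.mul_pos hK (Nat.two_pow_pos σ)
  have hNr : (0 : ℝ) < (K₁ * 2 ^ σ : ℕ) := by exact_mod_cast hN
  set N := K₁ * 2 ^ σ with hNdef
  set θ : ℕ → ℝ := fun y => (((y : ℤ) - x : ℤ) : ℝ) / 2 ^ (q + σ) with hθ
  rw [localisedWalsh_eq_sum_fejer hK, norm_mul, norm_inv, norm_pow, Complex.norm_two]
  have hP : (0 : ℝ) < 2 ^ (q + σ) := by positivity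
  rw [inv_mul_le_iff₀ hP]
  calc ‖∑ y ∈ range (2 ^ (q + σ)), (walshNat A y : ℂ) *
        (((fejerSum (2 * N) (θ y) - fejerSum N (θ y)) / (N : ℕ) : ℝ) : ℂ)‖
      ≤ ∑ y ∈ range (2 ^ (q + σ)), (fejerSum (2 * N) (θ y) + fejerSum N (θ y)) / N := by
        refine (norm_sum_le _ _).trans (Finset.sum_le_sum fun y _ => ?_)
        rw [norm_mul, Complex.norm_real, Complex.norm_real, Real.norm_eq_abs, abs_walshNat, one_mul,
          Real.norm_eq_abs, abs_div, Nat.abs_cast]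
        refine div_le_div_of_nonneg_right ((abs_sub _ _).trans ?_) hNr.le
        rw [abs_of_nonneg (fejerSum_nonneg _ _), abs_of_nonneg (fejerSum_nonneg _ _)]
    _ = (2 ^ (q + σ) * (2 * N : ℕ) + 2 ^ (q + σ) * (N : ℕ)) / N := by
        rw [← Finset.sum_div, Finset.sum_add_distrib, sum_fejerSum_sub_div _ h2N,
          sum_fejerSum_sub_div _ (le_trans (by omega) h2N)]
    _ = 2 ^ (q + σ) * 3 := by push_cast; field_simp; ring

end Localised

/-! ### The `ℓ²` tail of `ŵ_A` for `A` on the top `σ` digits (replaces (1.16)–(1.21)) -/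

/-- **Pointwise tail decay**: if every digit of `A ⊆ {0,…,q+σ-1}` is `≥ q`, then for an integer
frequency `k` with `j 2^σ ≤ |k| ≤ 2^{q+σ}/2` (`j ≥ 1`),
`|ŵ_A(k/2^{q+σ})| ≤ (2j)⁻¹ |ŵ_{A'}(k/2^σ)|` (factorisation (1.15) and the decay of the Dirichlet
factor of the `q` free low digits). [cite: Bourgain2013MoebiusWalsh, (1.14)–(1.15)] -/
theorem norm_walshCoeff_le_of_top {q σ : ℕ} (A : Finset (Fin (q + σ))) (hA : ∀ j ∈ A, q ≤ (j : ℕ))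
    {k : ℤ} {j : ℕ} (hj : 0 < j) (hjk : (j : ℝ) * 2 ^ σ ≤ |(k : ℝ)|) (hkP : 2 * |(k : ℝ)| ≤ 2 ^ (q + σ)) :
    ‖walshCoeff A ((k : ℝ) / 2 ^ (q + σ))‖ ≤
      1 / (2 * j) * ‖walshCoeff (topShift q σ A) ((k : ℝ) / 2 ^ σ)‖ := by
  have hjr : (0 : ℝ) < j := by exact_mod_cast hj
  have hkpos : 0 < |(k : ℝ)| := lt_of_lt_of_le (by positivity) hjk
  have hP : (0 : ℝ) < 2 ^ (q + σ) := by positivity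
  set θ : ℝ := (k : ℝ) / 2 ^ (q + σ) with hθ
  have hθ0 : θ ≠ 0 := div_ne_zero (abs_pos.1 hkpos) hP.ne'
  have hθabs : |θ| = |(k : ℝ)| / 2 ^ (q + σ) := by rw [hθ, abs_div, abs_of_pos hP]
  have hθhalf : |θ| ≤ 1 / 2 := by
    rw [hθabs, div_le_iff₀ hP]; linarith
  rw [walshCoeff_eq_dirichletCoeff_mul A hA, norm_mul,
    show (2 : ℝ) ^ q * θ = (k : ℝ) / 2 ^ σ by rw [hθ, pow_add]; field_simp]
  refine mul_le_mul_of_nonneg_right ?_ (norm_nonneg _)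
  refine (norm_dirichletCoeff_le hθ0 hθhalf q).trans ?_
  rw [hθabs, div_eq_mul_inv |(k : ℝ)|, pow_add]
  rw [show ((2 : ℝ) ^ q)⁻¹ * (1 / (2 * (|(k : ℝ)| * ((2 : ℝ) ^ q * 2 ^ σ)⁻¹))) = 2 ^ σ / (2 * |(k : ℝ)|) by
    field_simp]
  rw [div_le_div_iff₀ (by positivity) (by positivity)]
  nlinarith

/-- One block of `2^σ` consecutive tail frequencies `[b, b + 2^σ)` at distance `≥ j 2^σ` from `0`
(and within `|k| ≤ 2^{q+σ}/2`) carries `ℓ²`-mass `≤ 1/(2j)²` (Parseval for `ŵ_{A'}` on the block).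
[cite: Bourgain2013MoebiusWalsh, Lemma 5 (proof)] -/
theorem sum_block_norm_sq_walshCoeff_le {q σ : ℕ} (A : Finset (Fin (q + σ))) (hA : ∀ j ∈ A, q ≤ (j : ℕ))
    (b : ℤ) {j : ℕ} (hj : 0 < j)
    (hblock : ∀ k ∈ Ico b (b + (2 ^ σ : ℕ)), (j : ℝ) * 2 ^ σ ≤ |(k : ℝ)| ∧ 2 * |(k : ℝ)| ≤ 2 ^ (q + σ)) :
    ∑ k ∈ Ico b (b + (2 ^ σ : ℕ)), ‖walshCoeff A ((k : ℝ) / 2 ^ (q + σ))‖ ^ 2 ≤ (1 / (2 * j)) ^ 2 := by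
  calc ∑ k ∈ Ico b (b + (2 ^ σ : ℕ)), ‖walshCoeff A ((k : ℝ) / 2 ^ (q + σ))‖ ^ 2
      ≤ ∑ k ∈ Ico b (b + (2 ^ σ : ℕ)),
          (1 / (2 * j)) ^ 2 * ‖walshCoeff (topShift q σ A) ((k : ℝ) / 2 ^ σ)‖ ^ 2 := by
        refine Finset.sum_le_sum fun k hk => ?_
        rw [← mul_pow]
        exact pow_le_pow_left₀ (norm_nonneg _)
          (norm_walshCoeff_le_of_top A hA hj (hblock k hk).1 (hblock k hk).2) 2
    _ = (1 / (2 * j)) ^ 2 := by rw [← Finset.mul_sum, sum_Ico_norm_sq_walshCoeff, mul_one]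

/-- **Positive tail**: with `N = K₁2^σ`, `H = Q' 2^σ` (`Q' ≥ K₁ ≥ 2`, `2H ≤ 2^{q+σ}`),
`∑_{N ≤ k < H} |ŵ_A(k/2^{q+σ})|² ≤ 1/(4(K₁-1))`. [cite: Bourgain2013MoebiusWalsh, Lemma 5 (proof)] -/
theorem sum_tail_pos_le {q σ K₁ Q' : ℕ} (A : Finset (Fin (q + σ))) (hA : ∀ j ∈ A, q ≤ (j : ℕ))
    (hK : 2 ≤ K₁) (hKQ : K₁ ≤ Q') (hQ : 2 * (Q' * 2 ^ σ) ≤ 2 ^ (q + σ)) :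
    ∑ k ∈ Ico ((K₁ * 2 ^ σ : ℕ) : ℤ) ((Q' * 2 ^ σ : ℕ) : ℤ), ‖walshCoeff A ((k : ℝ) / 2 ^ (q + σ))‖ ^ 2 ≤
      1 / (4 * ((K₁ : ℝ) - 1)) := by
  have hsplit := sum_Ico_int_blocks (fun k : ℤ => ‖walshCoeff A ((k : ℝ) / 2 ^ (q + σ))‖ ^ 2)
    ((K₁ * 2 ^ σ : ℕ) : ℤ) (2 ^ σ) (Q' - K₁)
  rw [show ((K₁ * 2 ^ σ : ℕ) : ℤ) + ((Q' - K₁ : ℕ) : ℤ) * ((2 ^ σ : ℕ) : ℤ) = ((Q' * 2 ^ σ : ℕ) : ℤ) by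
    push_cast; rw [Nat.cast_sub hKQ]; ring] at hsplit
  rw [hsplit]
  have hQr : (2 : ℝ) * (Q' * 2 ^ σ) ≤ 2 ^ (q + σ) := by exact_mod_cast hQ
  calc ∑ i ∈ range (Q' - K₁), ∑ k ∈ Ico (((K₁ * 2 ^ σ : ℕ) : ℤ) + (i : ℕ) * ((2 ^ σ : ℕ) : ℤ))
          (((K₁ * 2 ^ σ : ℕ) : ℤ) + ((i : ℕ) + 1) * ((2 ^ σ : ℕ) : ℤ)), ‖walshCoeff A ((k : ℝ) / 2 ^ (q + σ))‖ ^ 2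
      ≤ ∑ i ∈ range (Q' - K₁), (1 / (2 * ((K₁ + i : ℕ) : ℝ))) ^ 2 := by
        refine Finset.sum_le_sum fun i hi => ?_
        rw [Finset.mem_range] at hi
        have hb : ((K₁ * 2 ^ σ : ℕ) : ℤ) + ((i : ℕ) + 1) * ((2 ^ σ : ℕ) : ℤ) =
            (((K₁ * 2 ^ σ : ℕ) : ℤ) + (i : ℕ) * ((2 ^ σ : ℕ) : ℤ)) + (2 ^ σ : ℕ) := by push_cast; ring
        rw [hb]
        refine sum_block_norm_sq_walshCoeff_le A hA _ (by omega) fun k hk => ?_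
        rw [Finset.mem_Ico] at hk
        have hk1 : ((K₁ : ℝ) + i) * 2 ^ σ ≤ (k : ℝ) := by
          have : ((K₁ * 2 ^ σ : ℕ) : ℤ) + (i : ℕ) * ((2 ^ σ : ℕ) : ℤ) ≤ k := hk.1
          have h' : ((K₁ : ℝ) * 2 ^ σ) + (i : ℝ) * 2 ^ σ ≤ (k : ℝ) := by exact_mod_cast this
          linarith
        have hk2 : (k : ℝ) + 1 ≤ ((K₁ : ℝ) + i + 1) * 2 ^ σ := by
          have : k + 1 ≤ ((K₁ * 2 ^ σ : ℕ) : ℤ) + (i : ℕ) * ((2 ^ σ : ℕ) : ℤ) + (2 ^ σ : ℕ) := hk.2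
          have h' : (k : ℝ) + 1 ≤ ((K₁ : ℝ) * 2 ^ σ) + (i : ℝ) * 2 ^ σ + 2 ^ σ := by exact_mod_cast this
          linarith
        have hi' : (K₁ : ℝ) + i + 1 ≤ Q' := by
          have : K₁ + i + 1 ≤ Q' := by omega
          exact_mod_cast this
        have hkpos : (0 : ℝ) < k := lt_of_lt_of_le (by positivity) hk1
        rw [abs_of_pos hkpos]
        refine ⟨by push_cast; linarith, ?_⟩
        have h2σ : (0 : ℝ) < 2 ^ σ := by positivity
        nlinarith
    _ ≤ 1 / (4 * ((K₁ : ℝ) - 1)) := by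
        have h := sum_range_one_div_sq_le hK (Q' - K₁)
        have hK1 : (1 : ℝ) < K₁ := by exact_mod_cast hK
        calc ∑ i ∈ range (Q' - K₁), (1 / (2 * ((K₁ + i : ℕ) : ℝ))) ^ 2
            = (1 / 4) * ∑ i ∈ range (Q' - K₁), 1 / (((K₁ + i : ℕ) : ℝ)) ^ 2 := by
              rw [Finset.mul_sum]
              refine Finset.sum_congr rfl fun i _ => ?_
              have : (0 : ℝ) < ((K₁ + i : ℕ) : ℝ) := by positivity
              field_simp; ring
          _ ≤ (1 / 4) * (1 / ((K₁ : ℝ) - 1)) := by gcongr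
          _ = 1 / (4 * ((K₁ : ℝ) - 1)) := by field_simp

/-- **Negative tail**: with `N = K₁2^σ`, `H = Q' 2^σ` (`Q' ≥ K₁ ≥ 2`, `2H ≤ 2^{q+σ}`),
`∑_{-H ≤ k < -N} |ŵ_A(k/2^{q+σ})|² ≤ 1/(4(K₁-1))`. [cite: Bourgain2013MoebiusWalsh, Lemma 5 (proof)] -/
theorem sum_tail_neg_le {q σ K₁ Q' : ℕ} (A : Finset (Fin (q + σ))) (hA : ∀ j ∈ A, q ≤ (j : ℕ))
    (hK : 2 ≤ K₁) (hKQ : K₁ ≤ Q') (hQ : 2 * (Q' * 2 ^ σ) ≤ 2 ^ (q + σ)) :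
    ∑ k ∈ Ico (-((Q' * 2 ^ σ : ℕ) : ℤ)) (-((K₁ * 2 ^ σ : ℕ) : ℤ)), ‖walshCoeff A ((k : ℝ) / 2 ^ (q + σ))‖ ^ 2 ≤
      1 / (4 * ((K₁ : ℝ) - 1)) := by
  have hsplit := sum_Ico_int_blocks (fun k : ℤ => ‖walshCoeff A ((k : ℝ) / 2 ^ (q + σ))‖ ^ 2)
    (-((Q' * 2 ^ σ : ℕ) : ℤ)) (2 ^ σ) (Q' - K₁)
  rw [show (-((Q' * 2 ^ σ : ℕ) : ℤ)) + ((Q' - K₁ : ℕ) : ℤ) * ((2 ^ σ : ℕ) : ℤ) = -((K₁ * 2 ^ σ : ℕ) : ℤ) by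
    push_cast; rw [Nat.cast_sub hKQ]; ring] at hsplit
  rw [hsplit]
  have hQr : (2 : ℝ) * (Q' * 2 ^ σ) ≤ 2 ^ (q + σ) := by exact_mod_cast hQ
  calc ∑ i ∈ range (Q' - K₁), ∑ k ∈ Ico (-((Q' * 2 ^ σ : ℕ) : ℤ) + (i : ℕ) * ((2 ^ σ : ℕ) : ℤ))
          (-((Q' * 2 ^ σ : ℕ) : ℤ) + ((i : ℕ) + 1) * ((2 ^ σ : ℕ) : ℤ)), ‖walshCoeff A ((k : ℝ) / 2 ^ (q + σ))‖ ^ 2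
      ≤ ∑ i ∈ range (Q' - K₁), (1 / (2 * ((K₁ + (Q' - K₁ - 1 - i) : ℕ) : ℝ))) ^ 2 := by
        refine Finset.sum_le_sum fun i hi => ?_
        rw [Finset.mem_range] at hi
        have hb : -((Q' * 2 ^ σ : ℕ) : ℤ) + ((i : ℕ) + 1) * ((2 ^ σ : ℕ) : ℤ) =
            (-((Q' * 2 ^ σ : ℕ) : ℤ) + (i : ℕ) * ((2 ^ σ : ℕ) : ℤ)) + (2 ^ σ : ℕ) := by push_cast; ring
        rw [hb]
        refine sum_block_norm_sq_walshCoeff_le A hA _ (by omega) fun k hk => ?_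
        rw [Finset.mem_Ico] at hk
        have hj : ((K₁ + (Q' - K₁ - 1 - i) : ℕ) : ℝ) = (Q' : ℝ) - 1 - i := by
          rw [show K₁ + (Q' - K₁ - 1 - i) = Q' - 1 - i by omega, Nat.cast_sub (by omega), Nat.cast_sub (by omega)]
          push_cast; ring
        have hk2 : (k : ℝ) + 1 ≤ -(((Q' : ℝ) - 1 - i) * 2 ^ σ) := by
          have : k + 1 ≤ -((Q' * 2 ^ σ : ℕ) : ℤ) + (i : ℕ) * ((2 ^ σ : ℕ) : ℤ) + (2 ^ σ : ℕ) := hk.2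
          have h' : (k : ℝ) + 1 ≤ -((Q' : ℝ) * 2 ^ σ) + (i : ℝ) * 2 ^ σ + 2 ^ σ := by exact_mod_cast this
          linarith
        have hk1 : -((Q' : ℝ) * 2 ^ σ) + (i : ℝ) * 2 ^ σ ≤ (k : ℝ) := by
          have : -((Q' * 2 ^ σ : ℕ) : ℤ) + (i : ℕ) * ((2 ^ σ : ℕ) : ℤ) ≤ k := hk.1
          exact_mod_cast this
        have hi' : (K₁ : ℝ) ≤ (Q' : ℝ) - 1 - i := by
          have : K₁ + i + 1 ≤ Q' := by omega
          have h' : ((K₁ + i + 1 : ℕ) : ℝ) ≤ Q' := by exact_mod_cast this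
          push_cast at h'; linarith
        have h2σ : (1 : ℝ) ≤ 2 ^ σ := one_le_pow₀ (by norm_num)
        have hkneg : (k : ℝ) < 0 := by
          have hK1 : (2 : ℝ) ≤ K₁ := by exact_mod_cast hK
          nlinarith
        rw [abs_of_neg hkneg, hj]
        refine ⟨by nlinarith, by nlinarith⟩
    _ = ∑ i ∈ range (Q' - K₁), (1 / (2 * ((K₁ + i : ℕ) : ℝ))) ^ 2 := by
        rw [← Finset.sum_range_reflect]
        refine Finset.sum_congr rfl fun i hi => ?_
        rw [Finset.mem_range] at hi
        rw [show K₁ + (Q' - K₁ - 1 - (Q' - K₁ - 1 - i)) = K₁ + i by omega]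
    _ ≤ 1 / (4 * ((K₁ : ℝ) - 1)) := by
        have h := sum_range_one_div_sq_le hK (Q' - K₁)
        have hK1 : (1 : ℝ) < K₁ := by exact_mod_cast hK
        calc ∑ i ∈ range (Q' - K₁), (1 / (2 * ((K₁ + i : ℕ) : ℝ))) ^ 2
            = (1 / 4) * ∑ i ∈ range (Q' - K₁), 1 / (((K₁ + i : ℕ) : ℝ)) ^ 2 := by
              rw [Finset.mul_sum]
              refine Finset.sum_congr rfl fun i _ => ?_
              have : (0 : ℝ) < ((K₁ + i : ℕ) : ℝ) := by positivity
              field_simp; ring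
          _ ≤ (1 / 4) * (1 / ((K₁ : ℝ) - 1)) := by gcongr
          _ = 1 / (4 * ((K₁ : ℝ) - 1)) := by field_simp

/-! ### Lemma 5, (1.12): the mean-square error `2^{-λ} ∑ |W_A - w_A|²` -/

/-- **Bourgain 2013, Lemma 5, (1.12)–(1.13) with (1.22) — PROVED, explicit form.** Let
`A ⊆ {q, …, q+σ-1}` (all digits `≥ q`; Bourgain's `A ⊂ [λ-σ, λ]` with `λ = q + σ`), `K₁ ≥ 2` with
`4K₁ ≤ 2^q`, `N = K₁2^σ`, `P = 2^{q+σ}`, and let `W_A(x) = ∑_{|k|<2N} η(k) ŵ_A(k/P) e(-kx/P)` be the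
de la Vallée-Poussin truncation (`localisedWalsh`; `η` = `trapezoid N`). Then
`∑_{x < P} |W_A(x) - w_A(x)|² ≤ P / (2(K₁ - 1))`, i.e. `(2^{-λ}∑|W_A - w_A|²)^{1/2} ≤ (2(K₁-1))^{-1/2}`
(Bourgain: `< 2^{-ct}` with `K₁ = 2^{t-1}`, under `t > C(log λ)²`; here no lower bound on `t` is
needed and `c = 1/2` up to the constant). Proof: by Parseval the error is
`∑_{N<|k|≤P/2} (1-η(k))²|ŵ_A(k/P)|² ≤ ∑_{N ≤ |k| ≤ P/2} |ŵ_A(k/P)|²`; by (1.15),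
`|ŵ_A(k/P)| = |D_q(k/P)|·|ŵ_{A'}(k/2^σ)|` with `|D_q(k/P)| ≤ 2^σ/(2|k|)`, and Parseval for `ŵ_{A'}`
on each block of `2^σ` consecutive `k` gives `≤ 2∑_{i ≥ K₁} (2i)^{-2} ≤ 1/(2(K₁-1))`.
[cite: Bourgain2013MoebiusWalsh, Lemma 5 (1.12)] -/
theorem sum_norm_sq_localisedWalsh_sub_walshNat_le {q σ K₁ : ℕ} (A : Finset (Fin (q + σ)))
    (hA : ∀ j ∈ A, q ≤ (j : ℕ)) (hK : 2 ≤ K₁) (hKq : 4 * K₁ ≤ 2 ^ q) :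
    ∑ x ∈ range (2 ^ (q + σ)), ‖localisedWalsh q σ K₁ A x - walshNat A x‖ ^ 2 ≤
      2 ^ (q + σ) / (2 * ((K₁ : ℝ) - 1)) := by
  -- the parameters `Q' = 2^q/2`, `H = Q'2^σ = P/2`, `N = K₁2^σ`
  have hq : q ≠ 0 := by rintro rfl; simp at hKq; omega
  obtain ⟨Q', hQ'⟩ : ∃ Q', 2 ^ q = 2 * Q' := ⟨2 ^ q / 2, by
    have : 2 ∣ 2 ^ q := dvd_pow_self 2 hq; omega⟩
  have hKQ : K₁ ≤ Q' := by omega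
  have hPH : 2 ^ (q + σ) = 2 * (Q' * 2 ^ σ) := by rw [pow_add, hQ']; ring
  have h2N : 2 * (K₁ * 2 ^ σ) ≤ Q' * 2 ^ σ := by nlinarith [Nat.one_le_two_pow (n := σ)]
  have hQ : 2 * (Q' * 2 ^ σ) ≤ 2 ^ (q + σ) := hPH.symm.le
  have hK0 : 0 < K₁ := by omega
  have hwin : -((Q' * 2 ^ σ : ℕ) : ℤ) + ((2 ^ (q + σ) : ℕ) : ℤ) = ((Q' * 2 ^ σ : ℕ) : ℤ) := by
    rw [hPH]; push_cast; ring
  -- Step 1: both `w_A` and `W_A` are trigonometric polynomials on the window `[-H, -H + P)`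
  have hw : ∀ x : ℕ, (walshNat A x : ℂ) = ∑ k ∈ Ico (-((Q' * 2 ^ σ : ℕ) : ℤ))
      (-((Q' * 2 ^ σ : ℕ) : ℤ) + ((2 ^ (q + σ) : ℕ) : ℤ)),
        walshCoeff A ((k : ℝ) / 2 ^ (q + σ)) * eChar (-(k * ((x : ℝ) / 2 ^ (q + σ)))) :=
    fun x => walshNat_eq_sum_Ico A x (Q' * 2 ^ σ)
  have hW : ∀ x : ℕ, localisedWalsh q σ K₁ A x = ∑ k ∈ Ico (-((Q' * 2 ^ σ : ℕ) : ℤ))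
      (-((Q' * 2 ^ σ : ℕ) : ℤ) + ((2 ^ (q + σ) : ℕ) : ℤ)),
        localisedCoeff q σ K₁ A k * eChar (-(k * ((x : ℝ) / 2 ^ (q + σ)))) := by
    intro x
    unfold localisedWalsh
    apply Finset.sum_subset
    · intro k hk
      rw [Finset.mem_Ioo] at hk
      rw [Finset.mem_Ico, hwin]
      push_cast at hk ⊢
      constructor <;> nlinarith
    · intro k hk hk'
      rw [Finset.mem_Ioo, not_and_or, not_lt, not_lt] at hk'
      rw [localisedCoeff_eq_zero A ?_, zero_mul]
      rcases hk' with h | h <;> omega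
  -- Step 2: Parseval for the difference
  have hdiff : ∀ x : ℕ, localisedWalsh q σ K₁ A x - walshNat A x = ∑ k ∈ Ico (-((Q' * 2 ^ σ : ℕ) : ℤ))
      (-((Q' * 2 ^ σ : ℕ) : ℤ) + ((2 ^ (q + σ) : ℕ) : ℤ)),
        (localisedCoeff q σ K₁ A k - walshCoeff A ((k : ℝ) / 2 ^ (q + σ))) *
          eChar (-(k * ((x : ℝ) / 2 ^ (q + σ)))) := by
    intro x
    rw [hW, hw, ← Finset.sum_sub_distrib]
    refine Finset.sum_congr rfl fun k _ => ?_
    ring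
  simp_rw [hdiff]
  rw [sum_norm_sq_trigPoly]
  -- Step 3: the coefficients of the difference
  have hcoef : ∀ k : ℤ, ‖localisedCoeff q σ K₁ A k - walshCoeff A ((k : ℝ) / 2 ^ (q + σ))‖ ^ 2 =
      (1 - trapezoid (K₁ * 2 ^ σ) k) ^ 2 * ‖walshCoeff A ((k : ℝ) / 2 ^ (q + σ))‖ ^ 2 := by
    intro k
    unfold localisedCoeff
    rw [show ∀ a b : ℂ, a * b - b = (a - 1) * b from fun a b => by ring, norm_mul, mul_pow,
      show ((trapezoid (K₁ * 2 ^ σ) k : ℝ) : ℂ) - 1 = ((trapezoid (K₁ * 2 ^ σ) k - 1 : ℝ) : ℂ) by push_cast; ring,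
      Complex.norm_real, Real.norm_eq_abs, sq_abs]
    ring
  have hle : ∀ k : ℤ, ‖localisedCoeff q σ K₁ A k - walshCoeff A ((k : ℝ) / 2 ^ (q + σ))‖ ^ 2 ≤
      ‖walshCoeff A ((k : ℝ) / 2 ^ (q + σ))‖ ^ 2 := fun k => by
    rw [hcoef]
    exact mul_le_of_le_one_left (sq_nonneg _) (sq_one_sub_trapezoid_le _ _)
  have hzero : ∀ k : ℤ, k.natAbs ≤ K₁ * 2 ^ σ →
      ‖localisedCoeff q σ K₁ A k - walshCoeff A ((k : ℝ) / 2 ^ (q + σ))‖ ^ 2 = 0 := fun k hk => by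
    rw [hcoef, trapezoid_eq_one (Nat.mul_pos hK0 (Nat.two_pow_pos σ)) hk]; ring
  -- Step 4: split the window `[-H, H) = [-H, -N) ∪ [-N, N) ∪ [N, H)`
  rw [hwin]
  set g : ℤ → ℝ := fun k => ‖localisedCoeff q σ K₁ A k - walshCoeff A ((k : ℝ) / 2 ^ (q + σ))‖ ^ 2 with hg
  have hsplit : ∑ k ∈ Ico (-((Q' * 2 ^ σ : ℕ) : ℤ)) ((Q' * 2 ^ σ : ℕ) : ℤ), g k =
      ∑ k ∈ Ico (-((Q' * 2 ^ σ : ℕ) : ℤ)) (-((K₁ * 2 ^ σ : ℕ) : ℤ)), g k +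
      ∑ k ∈ Ico (-((K₁ * 2 ^ σ : ℕ) : ℤ)) ((K₁ * 2 ^ σ : ℕ) : ℤ), g k +
      ∑ k ∈ Ico ((K₁ * 2 ^ σ : ℕ) : ℤ) ((Q' * 2 ^ σ : ℕ) : ℤ), g k := by
    have hKQz : (K₁ : ℤ) ≤ Q' := by exact_mod_cast hKQ
    have h2σz : (0 : ℤ) < 2 ^ σ := by positivity
    have hK0z : (0 : ℤ) < K₁ := by exact_mod_cast hK0
    rw [sum_Ico_int_split g (b := -((K₁ * 2 ^ σ : ℕ) : ℤ)) (by push_cast; nlinarith) (by push_cast; nlinarith),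
      sum_Ico_int_split g (a := -((K₁ * 2 ^ σ : ℕ) : ℤ)) (b := ((K₁ * 2 ^ σ : ℕ) : ℤ))
        (by push_cast; nlinarith) (by push_cast; nlinarith), add_assoc]
  have hmid : ∑ k ∈ Ico (-((K₁ * 2 ^ σ : ℕ) : ℤ)) ((K₁ * 2 ^ σ : ℕ) : ℤ), g k = 0 := by
    refine Finset.sum_eq_zero fun k hk => ?_
    rw [Finset.mem_Ico] at hk
    exact hzero k (by omega)
  have hneg : ∑ k ∈ Ico (-((Q' * 2 ^ σ : ℕ) : ℤ)) (-((K₁ * 2 ^ σ : ℕ) : ℤ)), g k ≤ 1 / (4 * ((K₁ : ℝ) - 1)) :=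
    (Finset.sum_le_sum fun k _ => hle k).trans (sum_tail_neg_le A hA hK hKQ hQ)
  have hpos : ∑ k ∈ Ico ((K₁ * 2 ^ σ : ℕ) : ℤ) ((Q' * 2 ^ σ : ℕ) : ℤ), g k ≤ 1 / (4 * ((K₁ : ℝ) - 1)) :=
    (Finset.sum_le_sum fun k _ => hle k).trans (sum_tail_pos_le A hA hK hKQ hQ)
  have hK1 : (1 : ℝ) < K₁ := by exact_mod_cast hK
  have htot : ∑ k ∈ Ico (-((Q' * 2 ^ σ : ℕ) : ℤ)) ((Q' * 2 ^ σ : ℕ) : ℤ), g k ≤ 1 / (2 * ((K₁ : ℝ) - 1)) := by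
    rw [hsplit, hmid, add_zero]
    have : 1 / (4 * ((K₁ : ℝ) - 1)) + 1 / (4 * ((K₁ : ℝ) - 1)) = 1 / (2 * ((K₁ : ℝ) - 1)) := by
      field_simp; ring
    linarith
  calc (2 : ℝ) ^ (q + σ) * ∑ k ∈ Ico (-((Q' * 2 ^ σ : ℕ) : ℤ)) ((Q' * 2 ^ σ : ℕ) : ℤ), g k
      ≤ 2 ^ (q + σ) * (1 / (2 * ((K₁ : ℝ) - 1))) := mul_le_mul_of_nonneg_left htot (by positivity)
    _ = 2 ^ (q + σ) / (2 * ((K₁ : ℝ) - 1)) := by ring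

/-! ### `W_A` is real-valued; packaged statement of Lemma 5 -/

/-- `conj Ŵ_A(k) = Ŵ_A(-k)`. [folklore] -/
theorem conj_localisedCoeff (q σ K₁ : ℕ) (A : Finset (Fin (q + σ))) (k : ℤ) :
    starRingEnd ℂ (localisedCoeff q σ K₁ A k) = localisedCoeff q σ K₁ A (-k) := by
  unfold localisedCoeff
  rw [map_mul, Complex.conj_ofReal, conj_walshCoeff, show trapezoid (K₁ * 2 ^ σ) k =
    trapezoid (K₁ * 2 ^ σ) (-k) by unfold trapezoid; rw [Int.natAbs_neg]]
  congr 1; push_cast; ring_nf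

/-- **`W_A` is real-valued** (`η` is even and `w_A` is real): `conj W_A(x) = W_A(x)`. [folklore] -/
theorem conj_localisedWalsh (q σ K₁ : ℕ) (A : Finset (Fin (q + σ))) (x : ℕ) :
    starRingEnd ℂ (localisedWalsh q σ K₁ A x) = localisedWalsh q σ K₁ A x := by
  unfold localisedWalsh
  rw [map_sum]
  refine Finset.sum_nbij' (fun k => -k) (fun k => -k) ?_ ?_ (fun k _ => neg_neg k) (fun k _ => neg_neg k) ?_
  · intro k hk
    rw [Finset.mem_Ioo] at hk ⊢
    omega
  · intro k hk
    rw [Finset.mem_Ioo] at hk ⊢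
    omega
  · intro k _
    rw [map_mul, conj_localisedCoeff, conj_eChar]
    congr 1; congr 1; push_cast; ring

/-- The real-valued reading of `W_A`. [cite: Bourgain2013MoebiusWalsh, (1.22)] -/
def localisedWalshRe (q σ K₁ : ℕ) (A : Finset (Fin (q + σ))) (x : ℕ) : ℝ := (localisedWalsh q σ K₁ A x).re

/-- `W_A(x)` equals its real part. [folklore] -/
theorem coe_localisedWalshRe (q σ K₁ : ℕ) (A : Finset (Fin (q + σ))) (x : ℕ) :
    (localisedWalshRe q σ K₁ A x : ℂ) = localisedWalsh q σ K₁ A x :=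
  Complex.conj_eq_iff_re.1 (conj_localisedWalsh q σ K₁ A x)

/-- **Bourgain 2013, Lemma 5 (second part: (1.12)–(1.13)) — PROVED, packaged as printed.**
"There is a bounded function `W_A` on `[0, 2^λ[ ∩ ℤ` satisfying `|Ŵ_A| ≤ |ŵ_A|` and
`(2^{-λ} ∑_{x<2^λ} |W_A(x) - w_A(x)|²)^{1/2} < 2^{-ct}` (1.12), `Ŵ_A(k) = 0` if `|k| > 2^{σ+t}` (1.13)",
for `A ⊂ [λ-σ, λ[`; moreover `‖W_A‖_∞ ≤ 3` ((1.22)). Here `λ = q + σ`, `A ⊆ {q,…,q+σ-1}`, the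
truncation parameter is `N = K₁2^σ` (`K₁ = 2^{t-1}` in the paper) with `K₁ ≥ 2`, `4K₁ ≤ 2^q`, and
the conclusion is explicit: there are coefficients `c(k)` (`= Ŵ_A(k)`), vanishing for `|k| ≥ 2N` and
dominated by `|ŵ_A(k/2^λ)|`, such that `W_A(x) = ∑_{|k|<2N} c(k) e(-kx/2^λ)` is real, `2^λ`-periodic,
bounded by `3`, and `∑_{x<2^λ} |W_A(x) - w_A(x)|² ≤ 2^λ/(2(K₁-1))`. The printed side condition
`C(log λ)² < t < (λ-σ)/2` is only needed in its upper half (`4K₁ ≤ 2^q`).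
[cite: Bourgain2013MoebiusWalsh, Lemma 5 (1.12)–(1.13), (1.22)] -/
theorem bourgain2013_lemma5_localised {q σ K₁ : ℕ} (A : Finset (Fin (q + σ)))
    (hA : ∀ j ∈ A, q ≤ (j : ℕ)) (hK : 2 ≤ K₁) (hKq : 4 * K₁ ≤ 2 ^ q) :
    ∃ (c : ℤ → ℂ) (W : ℕ → ℝ),
      (∀ k, ‖c k‖ ≤ ‖walshCoeff A ((k : ℝ) / 2 ^ (q + σ))‖) ∧
      (∀ k : ℤ, 2 * (K₁ * 2 ^ σ) ≤ k.natAbs → c k = 0) ∧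
      (∀ x, (W x : ℂ) = ∑ k ∈ Ioo (-((2 * (K₁ * 2 ^ σ) : ℕ) : ℤ)) ((2 * (K₁ * 2 ^ σ) : ℕ) : ℤ),
        c k * eChar (-(k * ((x : ℝ) / 2 ^ (q + σ))))) ∧
      (∀ x, |W x| ≤ 3) ∧ (∀ x, W (x + 2 ^ (q + σ)) = W x) ∧
      ∑ x ∈ range (2 ^ (q + σ)), (W x - walshNat A x) ^ 2 ≤ 2 ^ (q + σ) / (2 * ((K₁ : ℝ) - 1)) := by
  have hK0 : 0 < K₁ := by omega
  have h2N : 2 * (K₁ * 2 ^ σ) ≤ 2 ^ (q + σ) := by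
    rw [pow_add, ← mul_assoc]; exact Nat.mul_le_mul_right _ (by omega)
  refine ⟨localisedCoeff q σ K₁ A, localisedWalshRe q σ K₁ A, norm_localisedCoeff_le q σ K₁ A,
    fun k hk => localisedCoeff_eq_zero A hk, fun x => coe_localisedWalshRe q σ K₁ A x, fun x => ?_,
    fun x => ?_, ?_⟩
  · have h := norm_localisedWalsh_le hK0 h2N A x
    rwa [← coe_localisedWalshRe, Complex.norm_real, Real.norm_eq_abs] at h
  · have h := localisedWalsh_add_two_pow q σ K₁ A x
    rw [← coe_localisedWalshRe, ← coe_localisedWalshRe] at h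
    exact_mod_cast h
  · have h := sum_norm_sq_localisedWalsh_sub_walshNat_le A hA hK hKq
    refine le_trans (le_of_eq (Finset.sum_congr rfl fun x _ => ?_)) h
    rw [← coe_localisedWalshRe, ← Complex.ofReal_sub, Complex.norm_real, Real.norm_eq_abs, sq_abs]

end Literature.NumberTheory.LFunctions.MoebiusWalsh

end
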